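import Summits.HodgeConjecture.HodgeCM.Model.ToyG2.ThetaGram_2

/-! PORT of `HodgeCM/Model/ToyG2/ThetaGram.lean` (HodgeCMPerL run 82) — part 3: continuation of `Summits.HodgeConjecture.HodgeCM.Model.ToyG2.ThetaGram_2` (split at a top-level declaration boundary by port_pkg.py; scope re-opened below; declarations unchanged). -/

-- port_pkg: scope re-opened for this part (file-level context, then the namespace/section stack open at the cut)
open scoped TensorProduct InnerProductSpace
open HodgeCM.Toy HodgeCM.Toy.CMPresentation exteriorPower NumberField.ComplexEmbedding
open Literature.AlgebraicGeometry.Motives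
namespace HodgeCM.ToyG2.ThetaUiso
noncomputable section
open scoped Classical
section Vanishing
variable {L : CMField} (ι₁ : L →+* ℂ) (d t : ℚ) (q : Fin (nQ L ι₁))
/-- the pair pattern `(a,a,b,b)` (in either order of `a, b`) vanishes unless both pairs are conjugate pairs -/
theorem baseCA_ell_pair_eq_zero {a b : Fin 4} (hab : a ≠ b) (τ : Fin 4 → (FK L →+* ℂ))
    (h : τ 1 ≠ conjugate (τ 0) ∨ τ 3 ≠ conjugate (τ 2)) :
    baseCA (PP L (ΘOf L ι₁ q)) (ellLin L (ΘOf L ι₁ q) (ξOf L ι₁ q) d t)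
        (fun j => (PP L (ΘOf L ι₁ q)).eB (ix L (ΘOf L ι₁ q) (τ j) (![a, a, b, b] j))) = 0 := by
  rcases lt_or_gt_of_ne hab with hab' | hab'
  · rw [baseCA_ell_pair_eq L (ΘOf L ι₁ q) d t (ξOf_conj L ι₁ q) hab']
    rcases h with h | h
    · rw [if_neg h]; ring
    · rw [if_neg h]; ring
  · have hfam : (fun j => (PP L (ΘOf L ι₁ q)).eB (ix L (ΘOf L ι₁ q) (τ j) (![a, a, b, b] j)))
        = (fun j => (PP L (ΘOf L ι₁ q)).eB (ix L (ΘOf L ι₁ q) (![τ 2, τ 3, τ 0, τ 1] j) (![b, b, a, a] j)))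
            ∘ (Equiv.swap (0 : Fin 4) 2 * Equiv.swap (1 : Fin 4) 3) := by
      funext j
      fin_cases j <;> rfl
    rw [hfam, AlternatingMap.map_perm, baseCA_ell_pair_eq L (ΘOf L ι₁ q) d t (ξOf_conj L ι₁ q) hab']
    simp only [v4_0, v4_1, v4_2, v4_3]
    rcases h with h | h
    · rw [if_neg h]; simp
    · rw [if_neg h]; simp

/-- (Ported verbatim from the HodgeCMPerL package; no docstring in the source.) -/
theorem sameSlot_pattern01 {a a₂ a₃ : Fin 4} (h : ¬ (a₂ = a₃ ∧ a₂ ≠ a)) :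
    (∀ x y : Fin 4, x ≠ y →
      (Finset.univ.filter fun c => ![a, a, a₂, a₃] c = x).card < 2 ∨
        (Finset.univ.filter fun c => ![a, a, a₂, a₃] c = y).card < 2) ∧
    (∃ c₀ : Fin 4, ∀ c, ![a, a, a₂, a₃] c ≠ c₀) := by
  revert a a₂ a₃; decide

/-- (Ported verbatim from the HodgeCMPerL package; no docstring in the source.) -/
theorem sameSlot_pattern23 {a₀ a₁ b : Fin 4} (h : ¬ (a₀ = a₁ ∧ a₀ ≠ b)) :
    (∀ x y : Fin 4, x ≠ y →
      (Finset.univ.filter fun c => ![a₀, a₁, b, b] c = x).card < 2 ∨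
        (Finset.univ.filter fun c => ![a₀, a₁, b, b] c = y).card < 2) ∧
    (∃ c₀ : Fin 4, ∀ c, ![a₀, a₁, b, b] c ≠ c₀) := by
  revert a₀ a₁ b; decide

/-- **(P1)** two holomorphic classes of the SAME slot in positions `0, 1` kill the period -/
theorem baseCA_ell_sameSlot01 {a : Fin 4} (a₂ a₃ : Fin 4) {χ₀ χ₁ : FK L →+* ℂ} (ψ₂ ψ₃ : FK L →+* ℂ)
    (h₀ : χ₀.comp (eK L : L →+* FK L) ∈ (ΘOf L ι₁ q a).1)
    (h₁ : χ₁.comp (eK L : L →+* FK L) ∈ (ΘOf L ι₁ q a).1) :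
    baseCA (PP L (ΘOf L ι₁ q)) (ellLin L (ΘOf L ι₁ q) (ξOf L ι₁ q) d t)
        (fun j => (PP L (ΘOf L ι₁ q)).eB (ix L (ΘOf L ι₁ q) (![χ₀, χ₁, ψ₂, ψ₃] j) (![a, a, a₂, a₃] j))) = 0 := by
  by_cases h : a₂ = a₃ ∧ a₂ ≠ a
  · obtain ⟨rfl, hne⟩ := h
    exact baseCA_ell_pair_eq_zero ι₁ d t q (Ne.symm hne) _ (Or.inl (ne_conjugate_of_hol ι₁ q h₀ h₁))
  · rw [← baseC_mono]
    exact baseC_ell_mono_eq_zero L (ΘOf L ι₁ q) (ξOf L ι₁ q) d t _ _ (sameSlot_pattern01 h).1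
      (sameSlot_pattern01 h).2

/-- **(P2)** two holomorphic classes of the SAME slot in positions `2, 3` (conjugated) kill the period -/
theorem baseCA_ell_sameSlot23 (a₀ a₁ : Fin 4) {b : Fin 4} (ψ₀ ψ₁ : FK L →+* ℂ) {χ₂ χ₃ : FK L →+* ℂ}
    (h₂ : χ₂.comp (eK L : L →+* FK L) ∈ (ΘOf L ι₁ q b).1)
    (h₃ : χ₃.comp (eK L : L →+* FK L) ∈ (ΘOf L ι₁ q b).1) :
    baseCA (PP L (ΘOf L ι₁ q)) (ellLin L (ΘOf L ι₁ q) (ξOf L ι₁ q) d t)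
        (fun j => (PP L (ΘOf L ι₁ q)).eB (ix L (ΘOf L ι₁ q)
          (![ψ₀, ψ₁, conjugate χ₂, conjugate χ₃] j) (![a₀, a₁, b, b] j))) = 0 := by
  by_cases h : a₀ = a₁ ∧ a₀ ≠ b
  · obtain ⟨rfl, hne⟩ := h
    refine baseCA_ell_pair_eq_zero ι₁ d t q hne _ (Or.inr ?_)
    show conjugate χ₃ ≠ conjugate (conjugate χ₂)
    rw [Ne, conjugate_inj']
    exact ne_conjugate_of_hol ι₁ q h₂ h₃
  · rw [← baseC_mono]
    exact baseC_ell_mono_eq_zero L (ΘOf L ι₁ q) (ξOf L ι₁ q) d t _ _ (sameSlot_pattern23 h).1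
      (sameSlot_pattern23 h).2

/-- **(P3)** swapping positions `0, 1` flips the sign -/
theorem baseCA_ell_swap01 (x₀ x₁ x₂ x₃ : FK L →+* ℂ) (a₀ a₁ a₂ a₃ : Fin 4) :
    baseCA (PP L (ΘOf L ι₁ q)) (ellLin L (ΘOf L ι₁ q) (ξOf L ι₁ q) d t)
        (fun j => (PP L (ΘOf L ι₁ q)).eB (ix L (ΘOf L ι₁ q) (![x₁, x₀, x₂, x₃] j) (![a₁, a₀, a₂, a₃] j)))
      = - baseCA (PP L (ΘOf L ι₁ q)) (ellLin L (ΘOf L ι₁ q) (ξOf L ι₁ q) d t)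
        (fun j => (PP L (ΘOf L ι₁ q)).eB (ix L (ΘOf L ι₁ q) (![x₀, x₁, x₂, x₃] j) (![a₀, a₁, a₂, a₃] j))) := by
  have hfam : (fun j => (PP L (ΘOf L ι₁ q)).eB (ix L (ΘOf L ι₁ q) (![x₁, x₀, x₂, x₃] j) (![a₁, a₀, a₂, a₃] j)))
      = (fun j => (PP L (ΘOf L ι₁ q)).eB (ix L (ΘOf L ι₁ q) (![x₀, x₁, x₂, x₃] j) (![a₀, a₁, a₂, a₃] j)))
          ∘ Equiv.swap (0 : Fin 4) 1 := by
    funext j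
    fin_cases j <;> rfl
  rw [hfam, AlternatingMap.map_swap (hij := show (0 : Fin 4) ≠ 1 by decide)]

/-- **(P4)** swapping positions `2, 3` flips the sign -/
theorem baseCA_ell_swap23 (x₀ x₁ x₂ x₃ : FK L →+* ℂ) (a₀ a₁ a₂ a₃ : Fin 4) :
    baseCA (PP L (ΘOf L ι₁ q)) (ellLin L (ΘOf L ι₁ q) (ξOf L ι₁ q) d t)
        (fun j => (PP L (ΘOf L ι₁ q)).eB (ix L (ΘOf L ι₁ q) (![x₀, x₁, x₃, x₂] j) (![a₀, a₁, a₃, a₂] j)))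
      = - baseCA (PP L (ΘOf L ι₁ q)) (ellLin L (ΘOf L ι₁ q) (ξOf L ι₁ q) d t)
        (fun j => (PP L (ΘOf L ι₁ q)).eB (ix L (ΘOf L ι₁ q) (![x₀, x₁, x₂, x₃] j) (![a₀, a₁, a₂, a₃] j))) := by
  have hfam : (fun j => (PP L (ΘOf L ι₁ q)).eB (ix L (ΘOf L ι₁ q) (![x₀, x₁, x₃, x₂] j) (![a₀, a₁, a₃, a₂] j)))
      = (fun j => (PP L (ΘOf L ι₁ q)).eB (ix L (ΘOf L ι₁ q) (![x₀, x₁, x₂, x₃] j) (![a₀, a₁, a₂, a₃] j)))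
          ∘ Equiv.swap (2 : Fin 4) 3 := by
    funext j
    fin_cases j <;> rfl
  rw [hfam, AlternatingMap.map_swap (hij := show (2 : Fin 4) ≠ 3 by decide)]

variable (hd : (1 : ℚ) ≤ d) (ht : t ^ 2 = 16)

/-- (Ported verbatim from the HodgeCMPerL package; no docstring in the source.) -/
theorem valid_mkW {a b : Fin 4} (hab : a < b) {χ χ' : FK L →+* ℂ}
    (h : χ.comp (eK L : L →+* FK L) ∈ (ΘOf L ι₁ q a).1)
    (h' : χ'.comp (eK L : L →+* FK L) ∈ (ΘOf L ι₁ q b).1) :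
    (blockData ι₁ d t hd ht q).valid (mkW a b χ χ') := by
  rw [blockData_valid_iff]
  simp only [mkW, sh₁_shapeOf hab, sh₂_shapeOf hab]
  exact ⟨h, h'⟩

/-- `Λ(E_{a,χ}, E_{b,χ'}) = G_{(a,b;χ,χ')}` for a holomorphic pair with `a < b` … -/
theorem Λ_eCls_lt {a b : Fin 4} (hab : a < b) {χ χ' : FK L →+* ℂ}
    (h : χ.comp (eK L : L →+* FK L) ∈ (ΘOf L ι₁ q a).1)
    (h' : χ'.comp (eK L : L →+* FK L) ∈ (ΘOf L ι₁ q b).1) :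
    Λ ι₁ d t hd ht (eCls ι₁ d t q a χ) (eCls ι₁ d t q b χ') = Gv ι₁ d t hd ht q (mkW a b χ χ') := by
  rw [Λ_eCls_eCls, if_pos ⟨rfl, hab, valid_mkW ι₁ d t q hd ht hab h h'⟩,
    if_neg (fun hc => lt_asymm hab hc.2.1), sub_zero]

/-- … `= 0` on two classes of the same slot … -/
theorem Λ_eCls_self_slot (a : Fin 4) (χ χ' : FK L →+* ℂ) :
    Λ ι₁ d t hd ht (eCls ι₁ d t q a χ) (eCls ι₁ d t q a χ') = 0 := by
  rw [Λ_eCls_eCls, if_neg (fun hc => lt_irrefl _ hc.2.1), if_neg (fun hc => lt_irrefl _ hc.2.1), sub_zero]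

/-- … and `= -G_{(b,a;χ',χ)}` for `b < a` (alternation). -/
theorem Λ_eCls_gt {a b : Fin 4} (hba : b < a) {χ χ' : FK L →+* ℂ}
    (h : χ.comp (eK L : L →+* FK L) ∈ (ΘOf L ι₁ q a).1)
    (h' : χ'.comp (eK L : L →+* FK L) ∈ (ΘOf L ι₁ q b).1) :
    Λ ι₁ d t hd ht (eCls ι₁ d t q a χ) (eCls ι₁ d t q b χ') = - Gv ι₁ d t hd ht q (mkW b a χ' χ) := by
  rw [Λ_swap, Λ_eCls_lt ι₁ d t q hd ht hba h' h]

/-- **`inner_Λ` ON HOLOMORPHIC EIGENVECTOR QUADRUPLES OF ONE BLOCK**: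
`⟪Λ(E₂,E₃), Λ(E₀,E₁)⟫ = ¼ · ℓ_ℂ(e₀, e₁, ē₂, ē₃)`. -/
theorem inner_Λ_eCls_same (a₀ a₁ a₂ a₃ : Fin 4) (χ₀ χ₁ χ₂ χ₃ : FK L →+* ℂ)
    (h₀ : χ₀.comp (eK L : L →+* FK L) ∈ (ΘOf L ι₁ q a₀).1)
    (h₁ : χ₁.comp (eK L : L →+* FK L) ∈ (ΘOf L ι₁ q a₁).1)
    (h₂ : χ₂.comp (eK L : L →+* FK L) ∈ (ΘOf L ι₁ q a₂).1)
    (h₃ : χ₃.comp (eK L : L →+* FK L) ∈ (ΘOf L ι₁ q a₃).1) :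
    ⟪Λ ι₁ d t hd ht (eCls ι₁ d t q a₂ χ₂) (eCls ι₁ d t q a₃ χ₃),
        Λ ι₁ d t hd ht (eCls ι₁ d t q a₀ χ₀) (eCls ι₁ d t q a₁ χ₁)⟫_ℂ
      = (1 / 4 : ℂ) * baseCA (PP L (ΘOf L ι₁ q)) (ellLin L (ΘOf L ι₁ q) (ξOf L ι₁ q) d t)
        (fun j => (PP L (ΘOf L ι₁ q)).eB (ix L (ΘOf L ι₁ q)
          (![χ₀, χ₁, conjugate χ₂, conjugate χ₃] j) (![a₀, a₁, a₂, a₃] j))) := by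
  rcases lt_trichotomy a₀ a₁ with h01 | rfl | h01
  · rcases lt_trichotomy a₂ a₃ with h23 | rfl | h23
    · rw [Λ_eCls_lt ι₁ d t q hd ht h01 h₀ h₁, Λ_eCls_lt ι₁ d t q hd ht h23 h₂ h₃, inner_Gv, if_pos rfl,
        gram_eq_period ι₁ d t q hd ht _ _ (valid_mkW ι₁ d t q hd ht h01 h₀ h₁)
          (valid_mkW ι₁ d t q hd ht h23 h₂ h₃)]
      simp only [mkW, sh₁_shapeOf h01, sh₂_shapeOf h01, sh₁_shapeOf h23, sh₂_shapeOf h23]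
    · rw [Λ_eCls_self_slot, inner_zero_left, baseCA_ell_sameSlot23 ι₁ d t q a₀ a₁ _ _ h₂ h₃, mul_zero]
    · rw [Λ_eCls_lt ι₁ d t q hd ht h01 h₀ h₁, Λ_eCls_gt ι₁ d t q hd ht h23 h₂ h₃, inner_neg_left, inner_Gv,
        if_pos rfl, gram_eq_period ι₁ d t q hd ht _ _ (valid_mkW ι₁ d t q hd ht h01 h₀ h₁)
          (valid_mkW ι₁ d t q hd ht h23 h₃ h₂)]
      simp only [mkW, sh₁_shapeOf h01, sh₂_shapeOf h01, sh₁_shapeOf h23, sh₂_shapeOf h23]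
      rw [baseCA_ell_swap23]; ring
  · rw [Λ_eCls_self_slot, inner_zero_right, baseCA_ell_sameSlot01 ι₁ d t q a₂ a₃ _ _ h₀ h₁, mul_zero]
  · rcases lt_trichotomy a₂ a₃ with h23 | rfl | h23
    · rw [Λ_eCls_gt ι₁ d t q hd ht h01 h₀ h₁, Λ_eCls_lt ι₁ d t q hd ht h23 h₂ h₃, inner_neg_right, inner_Gv,
        if_pos rfl, gram_eq_period ι₁ d t q hd ht _ _ (valid_mkW ι₁ d t q hd ht h01 h₁ h₀)
          (valid_mkW ι₁ d t q hd ht h23 h₂ h₃)]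
      simp only [mkW, sh₁_shapeOf h01, sh₂_shapeOf h01, sh₁_shapeOf h23, sh₂_shapeOf h23]
      rw [baseCA_ell_swap01]; ring
    · rw [Λ_eCls_self_slot, inner_zero_left, baseCA_ell_sameSlot23 ι₁ d t q a₀ a₁ _ _ h₂ h₃, mul_zero]
    · rw [Λ_eCls_gt ι₁ d t q hd ht h01 h₀ h₁, Λ_eCls_gt ι₁ d t q hd ht h23 h₂ h₃, inner_neg_left,
        inner_neg_right, neg_neg, inner_Gv, if_pos rfl,
        gram_eq_period ι₁ d t q hd ht _ _ (valid_mkW ι₁ d t q hd ht h01 h₁ h₀)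
          (valid_mkW ι₁ d t q hd ht h23 h₃ h₂)]
      simp only [mkW, sh₁_shapeOf h01, sh₂_shapeOf h01, sh₁_shapeOf h23, sh₂_shapeOf h23]
      rw [baseCA_ell_swap01, baseCA_ell_swap23]; ring

/-- `Λ`-values of pairs from different blocks are orthogonal -/
theorem inner_Λ_eCls_of_ne {q₀ q₂ : Fin (nQ L ι₁)} (hq : q₂ ≠ q₀) (a₀ a₁ a₂ a₃ : Fin 4)
    (χ₀ χ₁ χ₂ χ₃ : FK L →+* ℂ) :
    ⟪Λ ι₁ d t hd ht (eCls ι₁ d t q₂ a₂ χ₂) (eCls ι₁ d t q₂ a₃ χ₃),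
        Λ ι₁ d t hd ht (eCls ι₁ d t q₀ a₀ χ₀) (eCls ι₁ d t q₀ a₁ χ₁)⟫_ℂ = 0 := by
  rw [Λ_eCls_eCls, Λ_eCls_eCls]
  simp only [true_and]
  split_ifs <;>
    simp [inner_sub_left, inner_Gv, Ne.symm hq]

end Vanishing

section Assembly

variable (d t : ℚ) {L : CMField} (ι₁ : L →+* ℂ) {V : HermSpace3 L ι₁} (Γ : Level V)
variable (hd : (1 : ℚ) ≤ d) (ht : t ^ 2 = 16)

/-- **`inner_Λ` ON HOLOMORPHIC EIGENVECTOR QUADRUPLES** (any blocks), with `c = ¼`: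
`⟪Λ(E₂,E₃), Λ(E₀,E₁)⟫ = ¼ · period(E₀, E₁, E₂, E₃)`. -/
theorem inner_Λ_eCls (q₀ q₁ q₂ q₃ : Fin (nQ L ι₁)) (a₀ a₁ a₂ a₃ : Fin 4) (χ₀ χ₁ χ₂ χ₃ : FK L →+* ℂ)
    (h₀ : χ₀.comp (eK L : L →+* FK L) ∈ (ΘOf L ι₁ q₀ a₀).1)
    (h₁ : χ₁.comp (eK L : L →+* FK L) ∈ (ΘOf L ι₁ q₁ a₁).1)
    (h₂ : χ₂.comp (eK L : L →+* FK L) ∈ (ΘOf L ι₁ q₂ a₂).1)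
    (h₃ : χ₃.comp (eK L : L →+* FK L) ∈ (ΘOf L ι₁ q₃ a₃).1) :
    ⟪Λ ι₁ d t hd ht (eCls ι₁ d t q₂ a₂ χ₂) (eCls ι₁ d t q₃ a₃ χ₃),
        Λ ι₁ d t hd ht (eCls ι₁ d t q₀ a₀ χ₀) (eCls ι₁ d t q₁ a₁ χ₁)⟫_ℂ
      = (1 / 4 : ℂ) * (toyUniverse₃ d t).period ((toyUniverse₃ d t).pms L ι₁ V Γ)
          ![eCls ι₁ d t q₀ a₀ χ₀, eCls ι₁ d t q₁ a₁ χ₁, eCls ι₁ d t q₂ a₂ χ₂, eCls ι₁ d t q₃ a₃ χ₃] := by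
  by_cases h01 : q₀ = q₁
  swap
  · have hΛ : Λ ι₁ d t hd ht (eCls ι₁ d t q₀ a₀ χ₀) (eCls ι₁ d t q₁ a₁ χ₁) = 0 := by
      rw [Λ_eCls_eCls, if_neg (fun h => h01 h.1.symm), if_neg (fun h => h01 h.1), sub_zero]
    have hp := period_eCls_mixed₃ d t ι₁ Γ ![q₀, q₁, q₂, q₃] ![a₀, a₁, a₂, a₃] ![χ₀, χ₁, χ₂, χ₃]
      (a := 0) (b := 1) h01
    simp only [v4_0, v4_1, v4_2, v4_3] at hp
    rw [hΛ, inner_zero_right, hp, mul_zero]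
  subst h01
  by_cases h23 : q₂ = q₃
  swap
  · have hΛ : Λ ι₁ d t hd ht (eCls ι₁ d t q₂ a₂ χ₂) (eCls ι₁ d t q₃ a₃ χ₃) = 0 := by
      rw [Λ_eCls_eCls, if_neg (fun h => h23 h.1.symm), if_neg (fun h => h23 h.1), sub_zero]
    have hp := period_eCls_mixed₃ d t ι₁ Γ ![q₀, q₀, q₂, q₃] ![a₀, a₁, a₂, a₃] ![χ₀, χ₁, χ₂, χ₃]
      (a := 2) (b := 3) h23
    simp only [v4_0, v4_1, v4_2, v4_3] at hp
    rw [hΛ, inner_zero_left, hp, mul_zero]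
  subst h23
  by_cases h02 : q₀ = q₂
  swap
  · have hp := period_eCls_mixed₃ d t ι₁ Γ ![q₀, q₀, q₂, q₂] ![a₀, a₁, a₂, a₃] ![χ₀, χ₁, χ₂, χ₃]
      (a := 0) (b := 2) h02
    simp only [v4_0, v4_1, v4_2, v4_3] at hp
    rw [hp, mul_zero]
    exact inner_Λ_eCls_of_ne ι₁ d t hd ht (fun h => h02 h.symm) a₀ a₁ a₂ a₃ χ₀ χ₁ χ₂ χ₃
  subst h02
  have hp := period_eCls_same₃ d t ι₁ Γ q₀ ![a₀, a₁, a₂, a₃] ![χ₀, χ₁, χ₂, χ₃]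
  simp only [v4_0, v4_1, v4_2, v4_3] at hp
  rw [hp]
  exact inner_Λ_eCls_same ι₁ d t q₀ hd ht a₀ a₁ a₂ a₃ χ₀ χ₁ χ₂ χ₃ h₀ h₁ h₂ h₃

/-- extension principle: two maps `M → ℂ`, both additive and `φ`-twisted homogeneous, that agree on a set
agree on its span -/
theorem eqOn_span_twist {M : Type*} [AddCommGroup M] [Module ℂ M] {s : Set M} {F G : M → ℂ} (φ : ℂ → ℂ)
    (hFa : ∀ x y, F (x + y) = F x + F y) (hFs : ∀ (c : ℂ) (x : M), F (c • x) = φ c * F x)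
    (hGa : ∀ x y, G (x + y) = G x + G y) (hGs : ∀ (c : ℂ) (x : M), G (c • x) = φ c * G x)
    (h : ∀ x ∈ s, F x = G x) : ∀ x ∈ Submodule.span ℂ s, F x = G x := by
  intro x hx
  induction hx using Submodule.span_induction with
  | mem x hx => exact h x hx
  | zero =>
    have hF : F 0 + F 0 = F 0 + 0 := by rw [add_zero, ← hFa, add_zero]
    have hG : G 0 + G 0 = G 0 + 0 := by rw [add_zero, ← hGa, add_zero]
    rw [add_left_cancel hF, add_left_cancel hG]
  | add x y _ _ hx hy => rw [hFa, hGa, hx, hy]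
  | smul c x _ hx => rw [hFs, hGs, hx]

/-! The (semi)linearity of the period of `toyUniverse₃` in each slot, restated over `V1` (the same terms as
`Universe.period4_add₀` …, at `rfl`-transparent types, so that `rw` finds them). -/
section period4

/-- (Ported verbatim from the HodgeCMPerL package; no docstring in the source.) -/
theorem period4_add₀' (x y x₁ x₂ x₃ : V1 ι₁ d t) :
    (toyUniverse₃ d t).period4 ((toyUniverse₃ d t).pms L ι₁ V Γ) (x + y) x₁ x₂ x₃
      = (toyUniverse₃ d t).period4 ((toyUniverse₃ d t).pms L ι₁ V Γ) x x₁ x₂ x₃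
        + (toyUniverse₃ d t).period4 ((toyUniverse₃ d t).pms L ι₁ V Γ) y x₁ x₂ x₃ :=
  Universe.period4_add₀ _ _ _ _ _ _ _

/-- (Ported verbatim from the HodgeCMPerL package; no docstring in the source.) -/
theorem period4_add₁' (x₀ x y x₂ x₃ : V1 ι₁ d t) :
    (toyUniverse₃ d t).period4 ((toyUniverse₃ d t).pms L ι₁ V Γ) x₀ (x + y) x₂ x₃
      = (toyUniverse₃ d t).period4 ((toyUniverse₃ d t).pms L ι₁ V Γ) x₀ x x₂ x₃
        + (toyUniverse₃ d t).period4 ((toyUniverse₃ d t).pms L ι₁ V Γ) x₀ y x₂ x₃ :=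
  Universe.period4_add₁ _ _ _ _ _ _ _

/-- (Ported verbatim from the HodgeCMPerL package; no docstring in the source.) -/
theorem period4_add₂' (x₀ x₁ x y x₃ : V1 ι₁ d t) :
    (toyUniverse₃ d t).period4 ((toyUniverse₃ d t).pms L ι₁ V Γ) x₀ x₁ (x + y) x₃
      = (toyUniverse₃ d t).period4 ((toyUniverse₃ d t).pms L ι₁ V Γ) x₀ x₁ x x₃
        + (toyUniverse₃ d t).period4 ((toyUniverse₃ d t).pms L ι₁ V Γ) x₀ x₁ y x₃ :=
  Universe.period4_add₂ _ _ _ _ _ _ _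

/-- (Ported verbatim from the HodgeCMPerL package; no docstring in the source.) -/
theorem period4_add₃' (x₀ x₁ x₂ x y : V1 ι₁ d t) :
    (toyUniverse₃ d t).period4 ((toyUniverse₃ d t).pms L ι₁ V Γ) x₀ x₁ x₂ (x + y)
      = (toyUniverse₃ d t).period4 ((toyUniverse₃ d t).pms L ι₁ V Γ) x₀ x₁ x₂ x
        + (toyUniverse₃ d t).period4 ((toyUniverse₃ d t).pms L ι₁ V Γ) x₀ x₁ x₂ y :=
  Universe.period4_add₃ _ _ _ _ _ _ _

/-- (Ported verbatim from the HodgeCMPerL package; no docstring in the source.) -/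
theorem period4_smul₀' (c : ℂ) (x x₁ x₂ x₃ : V1 ι₁ d t) :
    (toyUniverse₃ d t).period4 ((toyUniverse₃ d t).pms L ι₁ V Γ) (c • x) x₁ x₂ x₃
      = c * (toyUniverse₃ d t).period4 ((toyUniverse₃ d t).pms L ι₁ V Γ) x x₁ x₂ x₃ :=
  Universe.period4_smul₀ _ _ _ _ _ _ _

/-- (Ported verbatim from the HodgeCMPerL package; no docstring in the source.) -/
theorem period4_smul₁' (c : ℂ) (x₀ x x₂ x₃ : V1 ι₁ d t) :
    (toyUniverse₃ d t).period4 ((toyUniverse₃ d t).pms L ι₁ V Γ) x₀ (c • x) x₂ x₃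
      = c * (toyUniverse₃ d t).period4 ((toyUniverse₃ d t).pms L ι₁ V Γ) x₀ x x₂ x₃ :=
  Universe.period4_smul₁ _ _ _ _ _ _ _

/-- (Ported verbatim from the HodgeCMPerL package; no docstring in the source.) -/
theorem period4_smul₂' (c : ℂ) (x₀ x₁ x x₃ : V1 ι₁ d t) :
    (toyUniverse₃ d t).period4 ((toyUniverse₃ d t).pms L ι₁ V Γ) x₀ x₁ (c • x) x₃
      = starRingEnd ℂ c * (toyUniverse₃ d t).period4 ((toyUniverse₃ d t).pms L ι₁ V Γ) x₀ x₁ x x₃ :=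
  Universe.period4_smul₂ _ _ _ _ _ _ _

/-- (Ported verbatim from the HodgeCMPerL package; no docstring in the source.) -/
theorem period4_smul₃' (c : ℂ) (x₀ x₁ x₂ x : V1 ι₁ d t) :
    (toyUniverse₃ d t).period4 ((toyUniverse₃ d t).pms L ι₁ V Γ) x₀ x₁ x₂ (c • x)
      = starRingEnd ℂ c * (toyUniverse₃ d t).period4 ((toyUniverse₃ d t).pms L ι₁ V Γ) x₀ x₁ x₂ x :=
  Universe.period4_smul₃ _ _ _ _ _ _ _

end period4

/-- the holomorphic single eigenvectors, as a set -/
def holSet : Set (V1 ι₁ d t) :=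
  {ω | ∃ (k : Fin (nQ L ι₁)) (i : Fin 4) (τ' : FK L →+* ℂ),
    τ'.comp (eK L : L →+* FK L) ∈ (ΘOf L ι₁ k i).1 ∧ ω = eCls ι₁ d t k i τ'}

/-- extension principle, linear version -/
theorem eqOn_span_lin {M : Type*} [AddCommGroup M] [Module ℂ M] {s : Set M} {F G : M → ℂ}
    (hFa : ∀ x y, F (x + y) = F x + F y) (hFs : ∀ (c : ℂ) (x : M), F (c • x) = c * F x)
    (hGa : ∀ x y, G (x + y) = G x + G y) (hGs : ∀ (c : ℂ) (x : M), G (c • x) = c * G x)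
    (h : ∀ x ∈ s, F x = G x) : ∀ x ∈ Submodule.span ℂ s, F x = G x :=
  eqOn_span_twist id hFa hFs hGa hGs h

/-- `inner_Λ` with `c = ¼` on the holomorphic single eigenvectors themselves -/
theorem inner_Λ_holSet :
    ∀ x₀ ∈ holSet d t ι₁, ∀ x₁ ∈ holSet d t ι₁, ∀ x₂ ∈ holSet d t ι₁, ∀ x₃ ∈ holSet d t ι₁,
      ⟪Λ ι₁ d t hd ht x₂ x₃, Λ ι₁ d t hd ht x₀ x₁⟫_ℂ
        = (1 / 4 : ℂ) * (toyUniverse₃ d t).period4 ((toyUniverse₃ d t).pms L ι₁ V Γ) x₀ x₁ x₂ x₃ := by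
  rintro _ ⟨q₀, a₀, χ₀, h₀, rfl⟩ _ ⟨q₁, a₁, χ₁, h₁, rfl⟩ _ ⟨q₂, a₂, χ₂, h₂, rfl⟩ _ ⟨q₃, a₃, χ₃, h₃, rfl⟩
  have h := inner_Λ_eCls d t ι₁ Γ hd ht q₀ q₁ q₂ q₃ a₀ a₁ a₂ a₃ χ₀ χ₁ χ₂ χ₃ h₀ h₁ h₂ h₃
  rw [Universe.period_eq_period4] at h
  simp only [v4_0, v4_1, v4_2, v4_3] at h
  exact h

/-- … extended linearly in slot `0` -/
theorem inner_Λ_span₀ :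
    ∀ x₁ ∈ holSet d t ι₁, ∀ x₂ ∈ holSet d t ι₁, ∀ x₃ ∈ holSet d t ι₁, ∀ x₀ ∈ Submodule.span ℂ (holSet d t ι₁),
      ⟪Λ ι₁ d t hd ht x₂ x₃, Λ ι₁ d t hd ht x₀ x₁⟫_ℂ
        = (1 / 4 : ℂ) * (toyUniverse₃ d t).period4 ((toyUniverse₃ d t).pms L ι₁ V Γ) x₀ x₁ x₂ x₃ := by
  intro x₁ hx₁ x₂ hx₂ x₃ hx₃
  refine eqOn_span_lin ?_ ?_ ?_ ?_ (fun x₀ hx₀ => inner_Λ_holSet d t ι₁ Γ hd ht x₀ hx₀ x₁ hx₁ x₂ hx₂ x₃ hx₃)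
  · intro x y; simp only [map_add, LinearMap.add_apply, inner_add_right]
  · intro c x; simp only [map_smul, LinearMap.smul_apply, inner_smul_right]
  · intro x y; rw [period4_add₀']; ring
  · intro c x; rw [period4_smul₀']; ring

/-- … and in slot `1` -/
theorem inner_Λ_span₁ :
    ∀ x₂ ∈ holSet d t ι₁, ∀ x₃ ∈ holSet d t ι₁,
      ∀ x₀ ∈ Submodule.span ℂ (holSet d t ι₁), ∀ x₁ ∈ Submodule.span ℂ (holSet d t ι₁),
      ⟪Λ ι₁ d t hd ht x₂ x₃, Λ ι₁ d t hd ht x₀ x₁⟫_ℂ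
        = (1 / 4 : ℂ) * (toyUniverse₃ d t).period4 ((toyUniverse₃ d t).pms L ι₁ V Γ) x₀ x₁ x₂ x₃ := by
  intro x₂ hx₂ x₃ hx₃ x₀ hx₀
  refine eqOn_span_lin ?_ ?_ ?_ ?_ (fun x₁ hx₁ => inner_Λ_span₀ d t ι₁ Γ hd ht x₁ hx₁ x₂ hx₂ x₃ hx₃ x₀ hx₀)
  · intro x y; rw [map_add, inner_add_right]
  · intro c x; rw [LinearMap.map_smul, inner_smul_right]
  · intro x y; rw [period4_add₁']; ring
  · intro c x; rw [period4_smul₁']; ring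

/-- … and antilinearly in slot `2` -/
theorem inner_Λ_span₂ :
    ∀ x₃ ∈ holSet d t ι₁, ∀ x₀ ∈ Submodule.span ℂ (holSet d t ι₁),
      ∀ x₁ ∈ Submodule.span ℂ (holSet d t ι₁), ∀ x₂ ∈ Submodule.span ℂ (holSet d t ι₁),
      ⟪Λ ι₁ d t hd ht x₂ x₃, Λ ι₁ d t hd ht x₀ x₁⟫_ℂ
        = (1 / 4 : ℂ) * (toyUniverse₃ d t).period4 ((toyUniverse₃ d t).pms L ι₁ V Γ) x₀ x₁ x₂ x₃ := by
  intro x₃ hx₃ x₀ hx₀ x₁ hx₁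
  refine eqOn_span_twist (starRingEnd ℂ) ?_ ?_ ?_ ?_
    (fun x₂ hx₂ => inner_Λ_span₁ d t ι₁ Γ hd ht x₂ hx₂ x₃ hx₃ x₀ hx₀ x₁ hx₁)
  · intro x y; simp only [map_add, LinearMap.add_apply, inner_add_left]
  · intro c x; simp only [map_smul, LinearMap.smul_apply, inner_smul_left]
  · intro x y; rw [period4_add₂']; ring
  · intro c x; rw [period4_smul₂']; ring

/-- `inner_Λ` with `c = ¼` on the span of the holomorphic single eigenvectors (slot `3`, antilinearly) -/
theorem inner_Λ_span :
    ∀ x₀ ∈ Submodule.span ℂ (holSet d t ι₁), ∀ x₁ ∈ Submodule.span ℂ (holSet d t ι₁),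
      ∀ x₂ ∈ Submodule.span ℂ (holSet d t ι₁), ∀ x₃ ∈ Submodule.span ℂ (holSet d t ι₁),
      ⟪Λ ι₁ d t hd ht x₂ x₃, Λ ι₁ d t hd ht x₀ x₁⟫_ℂ
        = (1 / 4 : ℂ) * (toyUniverse₃ d t).period4 ((toyUniverse₃ d t).pms L ι₁ V Γ) x₀ x₁ x₂ x₃ := by
  intro x₀ hx₀ x₁ hx₁ x₂ hx₂
  refine eqOn_span_twist (starRingEnd ℂ) ?_ ?_ ?_ ?_
    (fun x₃ hx₃ => inner_Λ_span₂ d t ι₁ Γ hd ht x₃ hx₃ x₀ hx₀ x₁ hx₁ x₂ hx₂)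
  · intro x y; rw [map_add, inner_add_left]
  · intro c x; rw [LinearMap.map_smul, inner_smul_left]
  · intro x y; rw [period4_add₃']; ring
  · intro c x; rw [period4_smul₃']; ring


-- port_pkg: scope closed for this part
end Assembly
end
end HodgeCM.ToyG2.ThetaUiso
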